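import Summits.BirchSwinnertonDyer.BirchSwinnertonDyer.Theorems.EisensteinPrimesCrystalLambdaSigmaLocal
import HarnessLib

/-!
# Line «crystal» of crux 4 `BSDpOnCellC` (stmt-BirchSwinnertonDyer-19034), §L.4 as a TREE THEOREM — conjunct (II) of the line:
# `λ(P_Σ(E/K)) = Σ_{w∈Σ} curveLocalLambda κ (E/K) w`, i.e. the image of `P_Σ(E/K) = W.sigmaEulerElement p K κ` in `𝓞_{ℂ_p}⟦T⟧` has its FIRST UNIT
# COEFFICIENT EXACTLY at Keller–Yin's Σ-correction (`μ(P_Σ) = 0` with the exact `λ`)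
# (cell `bsd-eis`; mathematics and Lean text by ideator bsd-idea-12 g14, `Lines/crystal.lean` v3 §L.4; landed by the LEAD cruxlead-19034 g0;
# `--supports stmt-BirchSwinnertonDyer-19034`; namespace `…Theorems.CrystalLambdaSigma`, text otherwise VERBATIM)

HONEST FRAMING: kernel theorems about tree definitions; 0 defs, 0 named facts, 0 sorry; nothing about any `p`-adic `L`-function, Selmer group, main
conjecture or BSD is asserted or proved; 0 cells / labels / tiers move. General form `firstUnitCoeffAt_sigmaEulerElement` under
`∀ w ∈ Σ, κ.frobExponentAt w ≠ 0` only; `lambda_sigmaEulerElement` = the line's (II) VERBATIM (p ≠ 2, `K` imaginary quadratic, Heegner for `N_W`,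
`κ` anticyclotomic — `forall_frobExponentAt_ne_zero_of_satisfiesHeegnerHypothesis`; WITHOUT `c_w ≠ 0` the statement would be FALSE: `u = 1`,
`P_w(1) = #Ẽ(𝔽_w)` may be `≡ 0 mod p`). Reusable by any seat handling CGLS (2.16)-type Σ-terms (x2-p2, x11b, KY §1.5).

References: [KellerYin2024] §1.5 and Thm. 1.5.1 (arXiv:2402.12781v2 TeX L1337–1341); [CastellaGrossiLeeSkinner2022] Thm. 2.2.2 with (2.16);
[GreenbergVatsal2000] §2 Prop. (2.4); [Washington1997] §7.1; companion `…CrystalLambdaSigmaLocal.lean` (§L.1–§L.3).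
-/

set_option autoImplicit false
set_option linter.dupNamespace false

noncomputable section

namespace Summit.BirchSwinnertonDyer.BirchSwinnertonDyer.Theorems.CrystalLambdaSigma

open scoped Classical

open WeierstrassCurve NumberField IsDedekindDomain Field
open Literature.NumberTheory.EllipticCurves Literature.NumberTheory.EllipticCurves.GreenbergSelmer
  Literature.NumberTheory.EllipticCurves.IwasawaCharacter
  Literature.NumberTheory.EllipticCurves.BigGaloisRep
  Literature.NumberTheory.EllipticCurves.JetchevSkinnerWan2017
  Literature.NumberTheory.GaloisRepresentations
  Literature.NumberTheory.EllipticCurves.KellerYin2024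
open Summit.BirchSwinnertonDyer.Rank1Residual.X11b.Halves
  Summit.BirchSwinnertonDyer.Rank1Residual.X1.KellerYinHalves
  Summit.BirchSwinnertonDyer.Rank1Residual.X11b
  Summit.BirchSwinnertonDyer.BirchSwinnertonDyer.Theorems

section Sigma

variable {p : ℕ} [Fact p.Prime]

/-- Norm of the image of a `p`-adic integer under the structure map `ℤ_p → 𝓞_{ℂ_p}`. [folklore] -/
theorem norm_toCpInt (a : ℤ_[p]) : ‖((R1.toCpInt p a : PadicComplexInt p) : ℂ_[p])‖ = ‖a‖ := by
  rw [R1.coe_toCpInt, norm_algebraMap', PadicInt.padic_norm_e_of_padicInt]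

/-- Coefficient norms are preserved by `ℤ_p⟦T⟧ → 𝓞_{ℂ_p}⟦T⟧`. [folklore] -/
theorem norm_coeff_map_toCpInt (F : PowerSeries ℤ_[p]) (i : ℕ) :
    ‖((PowerSeries.coeff i (F.map (R1.toCpInt p)) : PadicComplexInt p) : ℂ_[p])‖ = ‖PowerSeries.coeff i F‖ := by
  rw [PowerSeries.coeff_map, norm_toCpInt]

/-- **`λ(P_Σ(E/K)) = Σ_{w∈Σ} curveLocalLambda κ (E/K) w`, `μ(P_Σ) = 0`, EXACT INDEX** in `𝓞_{ℂ_p}⟦T⟧`, as soon as every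
`c_w ≠ 0` on `Σ`: the first unit coefficient of `P_Σ = ∏_{w∈Σ} P_w` sits at the sum of the per-place indices (§L.3 and
Gauss's lemma `firstUnitCoeffAt_prod`), read through the isometries `ℤ_p → R₀`, `ℤ_p → 𝓞_{ℂ_p}`.
[cite: GreenbergVatsal2000, §2 Prop. (2.4) (p. 22)] [cite: CastellaGrossiLeeSkinner2022, Thm. 2.2.2 (the term `Σ λ(𝒫_w)`)]
[cite: Washington1997, §7.1 Prop. 7.2] -/
theorem firstUnitCoeffAt_sigmaEulerElement (W : WeierstrassCurve ℚ) [W.IsElliptic] [W.IsGloballyMinimal]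
    {K : Type} [Field K] [NumberField K] (κ : ZpExtension K p)
    (hc : ∀ w ∈ W.sigmaPlacesFinset p K, κ.frobExponentAt w ≠ 0) :
    ‖((PowerSeries.coeff (∑ w ∈ W.sigmaPlacesFinset p K, curveLocalLambda κ (W.baseChange K) w)
        (PowerSeries.map (R1.toCpInt p) (W.sigmaEulerElement p K κ)) : 𝓞_ℂ_[p]) : ℂ_[p])‖ = 1 ∧
      ∀ i < ∑ w ∈ W.sigmaPlacesFinset p K, curveLocalLambda κ (W.baseChange K) w,
        ‖((PowerSeries.coeff i (PowerSeries.map (R1.toCpInt p) (W.sigmaEulerElement p K κ)) : 𝓞_ℂ_[p]) :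
          ℂ_[p])‖ < 1 := by
  have hU := SigmaFactorFU.firstUnitCoeffAt_prod (W.sigmaPlacesFinset p K)
    (fun w ↦ (eulerFactor p ℤ_[p] (Ideal.absNorm w.asIdeal) ((W.baseChange K).localReductionDataAt w)
      (κ.frobExponentAt w)).map (toUnr p))
    (fun w ↦ curveLocalLambda κ (W.baseChange K) w)
    (fun w hw ↦ firstUnitCoeffAt_eulerFactor_sigmaPlace W κ hw (hc w hw))
  rw [← map_prod (PowerSeries.map (toUnr p))] at hU
  have hP : (∏ w ∈ W.sigmaPlacesFinset p K, eulerFactor p ℤ_[p] (Ideal.absNorm w.asIdeal)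
      ((W.baseChange K).localReductionDataAt w) (κ.frobExponentAt w)) = W.sigmaEulerElement p K κ := rfl
  rw [hP] at hU
  refine ⟨?_, fun i hi ↦ ?_⟩
  · have h := hU.1
    rw [SigmaFactorFU.norm_coeff_map_toUnr] at h
    rw [norm_coeff_map_toCpInt]
    exact h
  · have h := hU.2 i hi
    rw [SigmaFactorFU.norm_coeff_map_toUnr] at h
    rw [norm_coeff_map_toCpInt]
    exact h

/-- **Conjunct (II) of crystal v2's `stub_crystallineFibre`, PROVED** (hence dropped from the stub in v3): under the
all-split Heegner hypothesis (`K` imaginary quadratic, `p` odd, `κ` anticyclotomic) every `c_w ≠ 0` on `Σ`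
(`forall_frobExponentAt_ne_zero_of_satisfiesHeegnerHypothesis`, Brink), so §L.4 applies verbatim.
[cite: Brink2007, Thm. 2 (pp. 2134–2135)] [cite: GreenbergVatsal2000, §2 Prop. (2.4) (p. 22)]
[cite: CastellaGrossiLeeSkinner2022, Thm. 2.2.2 (the term `Σ λ(𝒫_w)`)] -/
theorem lambda_sigmaEulerElement :
    ∀ (W : WeierstrassCurve ℚ) [W.IsElliptic] [W.IsGloballyMinimal] (p : ℕ) [Fact p.Prime], p ≠ 2 →
      ∀ (K : Type) [Field K] [NumberField K], IsImaginaryQuadratic K →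
        SatisfiesHeegnerHypothesis (W.conductorNorm ℤ) K →
        ∀ (κ : ZpExtension K p), κ.IsAnticyclotomic →
          ‖((PowerSeries.coeff (∑ w ∈ W.sigmaPlacesFinset p K, curveLocalLambda κ (W.baseChange K) w)
              (PowerSeries.map (R1.toCpInt p) (W.sigmaEulerElement p K κ)) : 𝓞_ℂ_[p]) : ℂ_[p])‖ = 1 ∧
          ∀ i < ∑ w ∈ W.sigmaPlacesFinset p K, curveLocalLambda κ (W.baseChange K) w,
            ‖((PowerSeries.coeff i (PowerSeries.map (R1.toCpInt p) (W.sigmaEulerElement p K κ)) : 𝓞_ℂ_[p]) :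
              ℂ_[p])‖ < 1 := by
  intro W _ _ p _ hp2 K _ _ hK hH κ hκ
  exact firstUnitCoeffAt_sigmaEulerElement W κ
    (forall_frobExponentAt_ne_zero_of_satisfiesHeegnerHypothesis W p hp2 hK hH κ hκ)

end Sigma

end Summit.BirchSwinnertonDyer.BirchSwinnertonDyer.Theorems.CrystalLambdaSigma

end
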